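import Summits.BirchSwinnertonDyer.Rank1Residual.Iwasawa.UnitCoefficientFromRiemannSum
import Literature.NumberTheory.EllipticCurves.PlusSymbolBoundOddMultiplicativeProofs
import HarnessLib

/-!
# The unit-coefficient certificate from ONE certified Riemann sum, WITHOUT the symbol-bound clause,
# at an odd multiplicative prime in positive analytic rank (cell `b2b-bsdres`, lane CLASS-CLOSURE,
# seat `cc-typer-6` GEN 10; kernel companion of `Iwasawa/UnitCoefficientFromRiemannSum.lean` and of
# the census certificates at a MULTIPLICATIVE prime — O9's 57-cell window table
# `class-closure/O9/O9-window57-unitcoeff-instantiation.tsv`, N8's 138-row `N8-RS-TREE-INSTANTIATION.tsv`)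

HONEST FRAMING (run/shared/lean/b2b/bsd-rank1-residual/, verbatim in every file): prove what is
provable now; shrink each hard class to its core with data; no claim beyond stated classes.
Theorems only; no definition, no named fact; nothing about any particular curve is asserted; nothing
is booked; census / instrument output is EVIDENCE, never a Literature fact.

## What this file proves

The census's native certificate currency `Iwasawa.RiemannSumUnitCertAt W p n`
(`UnitCoefficientFromRiemannSum.lean`) asks, per newform `f` of `W` and period ratio `ϖ`, for THREE
things: a UNIFORM plus-symbol bound `∀ m a, ‖[a/pᵐ]⁺_f‖_p ≤ C` over ALL levels, the truncation
inequality `(C/‖k!‖_p)·p^{−n₀} < ‖RS k n₀‖` at ONE level `n₀`, and `‖ϖ·RS k n₀‖_p = 1`. A finite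
symbol table supplies the last two, never the first. At an ODD multiplicative prime in POSITIVE
analytic rank the first is a THEOREM with `C = 1`
(`IsNewformOf.norm_ratPlusSymbol_val_div_le_one_of_multiplicative_of_analyticRank_ne_zero`,
`Literature/…/PlusSymbolBoundOddMultiplicativeProofs.lean`: cusp class of `1/p` at `p ∥ N`, the
`U_p`-relation at the cusp `0`, `[0]⁺_f = L(E,1)/Ω⁺_f = 0`; no hypothesis on `E[p]`, the `p`-adic
image, optimality or the Manin constant). Hence:

* `riemannSumUnitCertAt_of_lt_of_analyticRank_ne_zero` — the two-clause datum (truncation inequality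
  with `C = 1` + unit Riemann sum, per `f, ϖ`, at one level) ⟹ `RiemannSumUnitCertAt W p n`;
* `unitCoeffAt_of_lt_of_analyticRank_ne_zero` — ⟹ `UnitCoeffAt W p n`
  (`unitCoeffAt_of_riemannSumUnitCertAt`), hence everything downstream (squeeze / minimal pairs /
  Schneider ∧ `Ш[p^∞]` finite in `UnitCoefficientCertificateMultiplicative.lean`; O9's
  `X2.bsdp_of_cellC_of_not_split_of_gvPar_of_thm1_of_unitCoeffAt_one`; N8's consumers; x11a's
  `μ_an(E,p) = 0` shape via `muAnZeroAt_of_unitCoeffAt`).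

So a census row at a multiplicative `p ≥ 3` of a rank-`≥ 1` curve instantiates the tree's certificate
LITERALLY from its tabled level alone, modulo the ONE stated-not-typed normalisation link (α) of the
lane (`engines' Néron-normalised x⁺_E = ±2ᵏ·ϖ·ratPlusSymbol f`; `class-closure/O9/…README-typer6.md` §3).

References: [MazurTateTeitelbaum1986Invent] §I.4 (4.2), §I.8, §I.10, §I.13; [CremonaAlgorithms1997]
§2.2 Lemma 2.2.3; [SteinWuthrich2013] §3, §4.2, §11 remark (p. 29); [GreenbergVatsal2000] p. 2–4;
HOME/IWASAWA-CENSUS.md §4.4, §4.6.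
-/

noncomputable section

open scoped Classical MatrixGroups ModularForm

open CongruenceSubgroup WeierstrassCurve Literature.NumberTheory.EllipticCurves
  Literature.NumberTheory.EllipticCurves.ModularForms

set_option autoImplicit false

namespace Summit.BirchSwinnertonDyer.Rank1Residual.Iwasawa

variable {W : WeierstrassCurve ℚ} {p : ℕ} [Fact p.Prime]

/-- **`RiemannSumUnitCertAt` without the symbol-bound clause**, at an odd multiplicative prime in
positive analytic rank: per newform `f` of `W` and `ϖ` with `ϖ·Ω_E = Ω⁺_f`, ONE level `n₀` with the
truncation inequality at `C = 1` and a unit scaled Riemann sum (non-split: signed measure at index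
`n`; split: index `n + 1`) give `RiemannSumUnitCertAt W p n` — the uniform bound `‖[a/pᵐ]⁺_f‖_p ≤ 1`
over all levels is supplied by
`IsNewformOf.norm_ratPlusSymbol_val_div_le_one_of_multiplicative_of_analyticRank_ne_zero`.
[cite: MazurTateTeitelbaum1986Invent, §I.4 (4.2), §I.8, §I.10 and §I.13]
[cite: CremonaAlgorithms1997, §2.2 Lemma 2.2.3] [cite: SteinWuthrich2013, §3 and §4.2] -/
theorem riemannSumUnitCertAt_of_lt_of_analyticRank_ne_zero (hp2 : p ≠ 2)
    (hmult : W.HasMultiplicativeReductionAtPrime p) (hr : W.analyticRank ≠ 0) {n : ℕ}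
    (h : ∀ {N : ℕ} [NeZero N] (f : CuspForm (Gamma0 N) 2), IsNewformOf W f →
      ∀ (ϖ : ℚ), (ϖ : ℝ) * W.realPeriodRat = plusPeriod f →
        (¬ W.HasSplitMultiplicativeReductionAtPrime p →
          ∃ (n₀ : ℕ) (RS : ℕ → ℕ → ℚ_[p]),
            (∀ k m : ℕ, RS k m =
              ∑ᶠ ξ : rootsOfUnity (torsionOrder p) ℤ_[p], ∑ s : ZMod (p ^ m),
                (fun (m : ℕ) (a : ZMod (p ^ m)) ↦
                    (-1 : ℚ_[p]) ^ m * (ratPlusSymbol f ((a.val : ℚ) / (p : ℚ) ^ m) : ℚ_[p]))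
                  (m + cyclotomicExponent p)
                    (PadicInt.toZModPow (m + cyclotomicExponent p) ((ξ : ℤ_[p]ˣ) : ℤ_[p]) *
                      (cyclotomicGenerator p : ZMod (p ^ (m + cyclotomicExponent p))) ^ s.val) *
                  ((s.val.choose k : ℕ) : ℚ_[p])) ∧
            1 / ‖((n.factorial : ℕ) : ℚ_[p])‖ * (p : ℝ) ^ (-n₀ : ℤ) < ‖RS n n₀‖ ∧
            ‖((ϖ : ℚ) : ℚ_[p]) * RS n n₀‖ = 1) ∧
        (W.HasSplitMultiplicativeReductionAtPrime p →
          ∃ (n₀ : ℕ) (RS : ℕ → ℕ → ℚ_[p]),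
            (∀ k m : ℕ, RS k m =
              ∑ᶠ ξ : rootsOfUnity (torsionOrder p) ℤ_[p], ∑ s : ZMod (p ^ m),
                (fun (m : ℕ) (a : ZMod (p ^ m)) ↦
                    (ratPlusSymbol f ((a.val : ℚ) / (p : ℚ) ^ m) : ℚ_[p]))
                  (m + cyclotomicExponent p)
                    (PadicInt.toZModPow (m + cyclotomicExponent p) ((ξ : ℤ_[p]ˣ) : ℤ_[p]) *
                      (cyclotomicGenerator p : ZMod (p ^ (m + cyclotomicExponent p))) ^ s.val) *
                  ((s.val.choose k : ℕ) : ℚ_[p])) ∧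
            1 / ‖(((n + 1).factorial : ℕ) : ℚ_[p])‖ * (p : ℝ) ^ (-n₀ : ℤ) < ‖RS (n + 1) n₀‖ ∧
            ‖((ϖ : ℚ) : ℚ_[p]) * RS (n + 1) n₀‖ = 1)) :
    RiemannSumUnitCertAt W p n := by
  intro N _ f hf ϖ hϖ
  have hC : ∀ (m : ℕ) (a : ZMod (p ^ m)),
      ‖(ratPlusSymbol f ((a.val : ℚ) / (p : ℚ) ^ m) : ℚ_[p])‖ ≤ 1 :=
    fun m a ↦ hf.norm_ratPlusSymbol_val_div_le_one_of_multiplicative_of_analyticRank_ne_zero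
      hp2 hmult hr m a
  obtain ⟨hns, hs⟩ := h f hf ϖ hϖ
  refine ⟨fun h' ↦ ?_, fun h' ↦ ?_⟩
  · obtain ⟨n₀, RS, hRS, hlt, hunit⟩ := hns h'
    exact ⟨1, n₀, RS, hRS, hC, hlt, hunit⟩
  · obtain ⟨n₀, RS, hRS, hlt, hunit⟩ := hs h'
    exact ⟨1, n₀, RS, hRS, hC, hlt, hunit⟩

/-- **The unit-coefficient certificate from ONE level**, at an odd multiplicative prime in positive
analytic rank: the two-clause Riemann-sum datum ⟹ `UnitCoeffAt W p n`
(`unitCoeffAt_of_riemannSumUnitCertAt` ∘ `riemannSumUnitCertAt_of_lt_of_analyticRank_ne_zero`).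
[cite: SteinWuthrich2013, §3, §4.2 and §11 remark (p. 29)] [cite: GreenbergVatsal2000, p. 2–3, (1)–(2)] -/
theorem unitCoeffAt_of_lt_of_analyticRank_ne_zero (hp2 : p ≠ 2)
    (hmult : W.HasMultiplicativeReductionAtPrime p) (hr : W.analyticRank ≠ 0) {n : ℕ}
    (h : ∀ {N : ℕ} [NeZero N] (f : CuspForm (Gamma0 N) 2), IsNewformOf W f →
      ∀ (ϖ : ℚ), (ϖ : ℝ) * W.realPeriodRat = plusPeriod f →
        (¬ W.HasSplitMultiplicativeReductionAtPrime p →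
          ∃ (n₀ : ℕ) (RS : ℕ → ℕ → ℚ_[p]),
            (∀ k m : ℕ, RS k m =
              ∑ᶠ ξ : rootsOfUnity (torsionOrder p) ℤ_[p], ∑ s : ZMod (p ^ m),
                (fun (m : ℕ) (a : ZMod (p ^ m)) ↦
                    (-1 : ℚ_[p]) ^ m * (ratPlusSymbol f ((a.val : ℚ) / (p : ℚ) ^ m) : ℚ_[p]))
                  (m + cyclotomicExponent p)
                    (PadicInt.toZModPow (m + cyclotomicExponent p) ((ξ : ℤ_[p]ˣ) : ℤ_[p]) *
                      (cyclotomicGenerator p : ZMod (p ^ (m + cyclotomicExponent p))) ^ s.val) *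
                  ((s.val.choose k : ℕ) : ℚ_[p])) ∧
            1 / ‖((n.factorial : ℕ) : ℚ_[p])‖ * (p : ℝ) ^ (-n₀ : ℤ) < ‖RS n n₀‖ ∧
            ‖((ϖ : ℚ) : ℚ_[p]) * RS n n₀‖ = 1) ∧
        (W.HasSplitMultiplicativeReductionAtPrime p →
          ∃ (n₀ : ℕ) (RS : ℕ → ℕ → ℚ_[p]),
            (∀ k m : ℕ, RS k m =
              ∑ᶠ ξ : rootsOfUnity (torsionOrder p) ℤ_[p], ∑ s : ZMod (p ^ m),
                (fun (m : ℕ) (a : ZMod (p ^ m)) ↦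
                    (ratPlusSymbol f ((a.val : ℚ) / (p : ℚ) ^ m) : ℚ_[p]))
                  (m + cyclotomicExponent p)
                    (PadicInt.toZModPow (m + cyclotomicExponent p) ((ξ : ℤ_[p]ˣ) : ℤ_[p]) *
                      (cyclotomicGenerator p : ZMod (p ^ (m + cyclotomicExponent p))) ^ s.val) *
                  ((s.val.choose k : ℕ) : ℚ_[p])) ∧
            1 / ‖(((n + 1).factorial : ℕ) : ℚ_[p])‖ * (p : ℝ) ^ (-n₀ : ℤ) < ‖RS (n + 1) n₀‖ ∧
            ‖((ϖ : ℚ) : ℚ_[p]) * RS (n + 1) n₀‖ = 1)) :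
    UnitCoeffAt W p n :=
  unitCoeffAt_of_riemannSumUnitCertAt hmult
    (riemannSumUnitCertAt_of_lt_of_analyticRank_ne_zero hp2 hmult hr h)

end Summit.BirchSwinnertonDyer.Rank1Residual.Iwasawa

end
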